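import Literature.NumberTheory.Automorphic.QuadraticCoordinatesIsotropicLine
import Literature.NumberTheory.Automorphic.UnitaryGroupDirectSum
import Literature.RepresentationTheory.HeisenbergGroup.SymplecticMatrixTransport
import HarnessLib

/-!
# The hermitian norm form in quadratic coordinates and its SPLIT model `(x, y) ↦ x ⬝ᵥ y`

Topic `NumberTheory/Automorphic`; namespace `Literature.NumberTheory.Automorphic.UnitaryGroup`.  KERNEL mathematics only:
theorems (no `def`, no named fact, no instance, no `sorry`).  Generic complement to ★ `UnitaryGroupSymplecticEmbedding` ∕
★ `QuadraticCoordinatesIsotropicLine` (`IsQuadraticCoordinates φ Ψ δ d`: `S = φ(R) ⊕ φ(R)δ`, `δ² = φ d`; `reIm`, `resAut`,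
`hermForm`, `im_hermForm_map`, `re_hermForm_map`).

THE MATHEMATICS ([Weil1965] Chap. II n° 21–23, pp. 32–36: over an algebra of type (II), i.e. `𝔎 × 𝔎` with the
exchange involution, a hermitian form reads `i_X(x, y) = ᵗy′·x` and its unitary group is `GL(m, 𝔎)` acting through
`(u, ᵗu′⁻¹)`; Chap. VI n° 52, pp. 77–78: at a place `v` of `k` split in the quadratic extension the local algebra is of
type (II); [Scharlau1985HermitianForms] Ch. 7 §6: hermitian forms over the split algebra `K × K` are hyperbolic).
For a hermitian matrix `H = T ⊗ 1` with `T ∈ Mₙ(R)`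
SYMMETRIC and `σ` the conjugation (`σ ∘ φ = φ`, `σ δ = -δ`):
* §1 from ★ `re_hermForm_map` (`re h(x, y) = aᵀ T a' - d · bᵀ T b'`, `QuadraticCoordinatesIsotropicLine`): the same read
  through the Darboux coordinates `u = (a, G b)` of the tree's doubled carrier
  (`G = reindex e e T`, ★ `darboux`, ★ `reindexW`, ★ `reIm` — literally the shape of ★ `Weil1965.UnitaryDoubling.toHermVec`):
  **`re h(z, z) = u₁ ⬝ᵥ G u₁ - d · (u₂ ⬝ᵥ G⁻¹ u₂)`** (`re_hermForm_darboux`);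
* §2 over a commutative ring with `Gᵀ = G` invertible and `s² = d`: the SPLIT FACTORISATION
  `u₁ ⬝ᵥ G u₁ - s²·(u₂ ⬝ᵥ G⁻¹ u₂) = (u₁ + s G⁻¹ u₂) ⬝ᵥ (G u₁ - s u₂)` (`dotProduct_sub_eq_split`);
* §3 over a field with `2 ≠ 0`, `s ≠ 0`: the coordinates `β(u) = (u₁ + s G⁻¹ u₂, G u₁ - s u₂)` form a LINEAR
  EQUIVALENCE `(ι ⊕ ι → K) ≃ₗ[K] (ι → K) × (ι → K)` with inverse `(p, q) ↦ (½(p + G⁻¹ q), (2s)⁻¹(G p - q))`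
  (`exists_splitEquiv`);
* §4 INTERTWINING: for `g ∈ U(σ, T.map φ)` with `g = g₁ + g₂ δ` the geometric action `u ↦ θ_G(g(θ_G⁻¹ u))`
  (`θ_G` = Darboux map, `g` acting through `resAut`) becomes, in the coordinates `β`, the DUAL PAIR
  `(p, q) ↦ (g_w p, (g_w⁻¹)ᵀ q)` with `g_w := g₁ + s g₂` («`w`-component of `g`»), `g_w ∈ GL` (`exists_gl_split_intertwine`; the coordinate form of
  unitarity is `conjTranspose_form_mul_eq_iff`: `g₁ᵀTg₁ - d g₂ᵀTg₂ = T`, `g₁ᵀTg₂ = g₂ᵀTg₁`);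
* §5 conversely every `g_w ∈ GL_ι(K)` arises from some `g ∈ U(σ, T.map φ)` (`exists_mem_unitaryGroupOfForm_of_gl`).

USE (cell `hodgecm-mathlib`, FLOOR-0 P4, ENGINE E-2, I-CLOSE sheet (BRIDGE-v) «β_v-half»): instantiated at `R = F_v`,
`S = E ⊗ F_v` (a place `v` of `F` split in `E = F(δ)`, i.e. `d ∈ F_v²`) this identifies Weil's fibres `hNorm = b` of the
doubled theta carrier with the fibres `x ⬝ᵥ y = b` of ★ `Weil1965/SplitPlaceFibreMeasure*`, equivariantly for
`U(J_V)(F_v) ≅ GL_N(F_v)` acting by `(g x, (g⁻¹)ᵀ y)`.  HC_CM is proved only modulo the printed citations until rung 0 closes.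

## References
* [Weil1965] A. Weil, *Sur la formule de Siegel dans la théorie des groupes classiques*, Acta Math. 113 (1965) 1–87,
  Chap. II n° 21–23 pp. 32–36 (type (II): `i_X(x, y) = ᵗy′·x`, `U ≅ GL(m, 𝔎)` via `(u, ᵗu′⁻¹)`), Chap. VI n° 52
  pp. 77–78 (split places), Chap. V n° 50 pp. 72–74 (Thm 4 and its proof at one place `v`).
* [Scharlau1985HermitianForms] W. Scharlau, *Quadratic and Hermitian Forms*, Grundlehren 270 (1985), Ch. 7 §6 (hermitian forms over
  `K × K` with the exchange involution are hyperbolic; `U ≅ GL`).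
* [GelbartRogawski1991] S. Gelbart, J. Rogawski, Invent. Math. 105 (1991), §3.1 p. 454 (the coordinates `Res_{E/F}`).
-/

noncomputable section

open Matrix
open scoped Matrix

namespace Literature.NumberTheory.Automorphic

namespace UnitaryGroup

open QuadraticCoordinates
open Literature.RepresentationTheory.HeisenbergGroup

/-! ## §1 `re h` in quadratic coordinates -/

namespace IsQuadraticCoordinates

variable {R S : Type*} [CommRing R] [CommRing S]
variable {φ : R →+* S} {Ψ : (R × R) ≃+ S} {δ : S} {d : R} (h : IsQuadraticCoordinates φ Ψ δ d)
include h

/-- **`re h(z, z)` THROUGH THE DARBOUX COORDINATES OF THE DOUBLED CARRIER.**  For `e : κ ≃ ι`, `T ∈ M_κ(R)` with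
`reindex e e T = G`, `G` invertible, `H = T.map φ`, and `u : ι ⊕ ι → R`, the vector
`z := reIm⁻¹ ((reindexW e)⁻¹ ((darboux G)⁻¹ u)) ∈ S^κ` (i.e. `z = a + bδ` with `a = u₁ ∘ e`, `b = (G⁻¹ u₂) ∘ e`,
`u₁ = u ∘ inl`, `u₂ = u ∘ inr`) has
`re h(z, z) = u₁ ⬝ᵥ G u₁ - d · (u₂ ⬝ᵥ G⁻¹ u₂)` — the hermitian norm is an `R`-rational quadratic form in the Darboux
coordinates. [cite: Weil1965, Chap. II n° 21–23, pp. 32–36; Chap. VI n° 52, pp. 77–78] -/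
theorem re_hermForm_darboux {κ ι : Type*} [Fintype κ] [DecidableEq κ] [Fintype ι] [DecidableEq ι] (e : κ ≃ ι)
    {T : Matrix κ κ R} {G : Matrix ι ι R} (hTG : Matrix.reindex e e T = G) (hG : IsUnit G.det)
    {H : Matrix κ κ S} (hH : H = T.map φ) {σ : S →+* S} (hσφ : ∀ a, σ (φ a) = φ a) (hσδ : σ δ = -δ)
    (u : ι ⊕ ι → R) :
    re Ψ (hermForm σ H ((reIm Ψ κ).symm ((reindexW R e).symm ((SymplecticMatrix.darboux G hG).symm u)))
        ((reIm Ψ κ).symm ((reindexW R e).symm ((SymplecticMatrix.darboux G hG).symm u)))) =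
      (u ∘ Sum.inl) ⬝ᵥ G *ᵥ (u ∘ Sum.inl) - d * ((u ∘ Sum.inr) ⬝ᵥ G⁻¹ *ᵥ (u ∘ Sum.inr)) := by
  subst hH
  -- `(x ∘ e)ᵀ T (y ∘ e) = xᵀ (reindex e e T) y`
  have hre : ∀ x y : ι → R, (x ∘ e) ⬝ᵥ T *ᵥ (y ∘ e) = x ⬝ᵥ G *ᵥ y := fun x y => by
    rw [← hTG, ← Matrix.toLinearMap₂'_apply', ← Matrix.toLinearMap₂'_apply', ← toLinearMap₂'_reindex e T]
    congr 1
    · congr 1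
      funext i
      simp only [Function.comp_apply, Equiv.apply_symm_apply]
    · funext i
      simp only [Function.comp_apply, Equiv.apply_symm_apply]
  rw [h.re_hermForm_map κ T hσφ hσδ, Matrix.toLinearMap₂'_apply', Matrix.toLinearMap₂'_apply', AddEquiv.apply_symm_apply,
    reindexW_symm_apply, SymplecticMatrix.darboux_symm_apply]
  dsimp only
  rw [hre, hre, Matrix.mulVec_mulVec, Matrix.mul_nonsing_inv G hG, Matrix.one_mulVec,
    dotProduct_comm (G⁻¹ *ᵥ (u ∘ Sum.inr))]

end IsQuadraticCoordinates

/-! ## §2 The split factorisation over a commutative ring -/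

section SplitAlgebra

variable {R : Type*} [CommRing R] {ι : Type*} [Fintype ι] [DecidableEq ι]

/-- `(G⁻¹ v)ᵀ (G w) = wᵀ v` for `G` symmetric invertible. [folklore] -/
private theorem nonsing_inv_mulVec_dotProduct_mulVec {G : Matrix ι ι R} (hG : G.IsSymm) (hGd : IsUnit G.det) (v w : ι → R) :
    (G⁻¹ *ᵥ v) ⬝ᵥ (G *ᵥ w) = w ⬝ᵥ v := by
  rw [dotProduct_mulVec, ← Matrix.mulVec_transpose, hG, Matrix.mulVec_mulVec, Matrix.mul_nonsing_inv G hGd,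
    Matrix.one_mulVec, dotProduct_comm]

/-- **THE SPLIT FACTORISATION**: for `G` symmetric invertible and any `s`,
`u₁ ⬝ᵥ G u₁ - s²·(u₂ ⬝ᵥ G⁻¹ u₂) = (u₁ + s G⁻¹ u₂) ⬝ᵥ (G u₁ - s u₂)` — at a place where `d = s²` the hermitian norm
form of §1 is the split form `(x, y) ↦ x ⬝ᵥ y` in the coordinates `x = u₁ + s G⁻¹ u₂`, `y = G u₁ - s u₂`.
[cite: Weil1965, Chap. II n° 21–23, pp. 32–36; Chap. VI n° 52, pp. 77–78] -/
theorem dotProduct_sub_eq_split {G : Matrix ι ι R} (hG : G.IsSymm) (hGd : IsUnit G.det) (s : R) (u₁ u₂ : ι → R) :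
    u₁ ⬝ᵥ G *ᵥ u₁ - (s * s) * (u₂ ⬝ᵥ G⁻¹ *ᵥ u₂) = (u₁ + s • G⁻¹ *ᵥ u₂) ⬝ᵥ (G *ᵥ u₁ - s • u₂) := by
  rw [add_dotProduct, dotProduct_sub, dotProduct_sub, smul_dotProduct, smul_dotProduct, dotProduct_smul, dotProduct_smul,
    nonsing_inv_mulVec_dotProduct_mulVec hG hGd, dotProduct_comm (G⁻¹ *ᵥ u₂) u₂]
  simp only [smul_eq_mul]
  ring

end SplitAlgebra

/-! ## §3 The split coordinates as a linear equivalence (field, `2 ≠ 0`, `s ≠ 0`) -/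

section SplitEquiv

variable {K : Type*} [Field K] {ι : Type*} [Fintype ι] [DecidableEq ι]

/-- **THE SPLIT COORDINATES ARE A LINEAR EQUIVALENCE.**  For `G` invertible, `s ≠ 0` and `2 ≠ 0` in the field `K`
there is a `K`-linear equivalence `β : K^{ι ⊔ ι} ≃ K^ι × K^ι` with
`β u = (u₁ + s G⁻¹ u₂, G u₁ - s u₂)` (`u₁ = u ∘ inl`, `u₂ = u ∘ inr`) and inverse
`β⁻¹(p, q) = (2⁻¹(p + G⁻¹ q), (2s)⁻¹(G p - q))`. [cite: Weil1965, Chap. II n° 21–23, pp. 32–36; Chap. VI n° 52, pp. 77–78] -/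
theorem exists_splitEquiv (G : Matrix ι ι K) (hGd : IsUnit G.det) {s : K} (hs : s ≠ 0) (h2 : (2 : K) ≠ 0) :
    ∃ β : (ι ⊕ ι → K) ≃ₗ[K] ((ι → K) × (ι → K)),
      (∀ u, β u = (u ∘ Sum.inl + s • G⁻¹ *ᵥ (u ∘ Sum.inr), G *ᵥ (u ∘ Sum.inl) - s • (u ∘ Sum.inr))) ∧
      (∀ p q, β.symm (p, q) = Sum.elim ((2 : K)⁻¹ • (p + G⁻¹ *ᵥ q)) ((2 * s)⁻¹ • (G *ᵥ p - q))) := by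
  have hGG : G⁻¹ * G = 1 := Matrix.nonsing_inv_mul G hGd
  have hGG' : G * G⁻¹ = 1 := Matrix.mul_nonsing_inv G hGd
  refine ⟨{ toFun := fun u => (u ∘ Sum.inl + s • G⁻¹ *ᵥ (u ∘ Sum.inr), G *ᵥ (u ∘ Sum.inl) - s • (u ∘ Sum.inr))
            invFun := fun pq => Sum.elim ((2 : K)⁻¹ • (pq.1 + G⁻¹ *ᵥ pq.2)) ((2 * s)⁻¹ • (G *ᵥ pq.1 - pq.2))
            map_add' := fun u v => ?_
            map_smul' := fun c u => ?_
            left_inv := fun u => ?_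
            right_inv := fun pq => ?_ }, fun u => rfl, fun p q => rfl⟩
  · refine Prod.ext ?_ ?_
    · change (u + v) ∘ Sum.inl + s • G⁻¹ *ᵥ ((u + v) ∘ Sum.inr) = _
      simp only [Pi.add_comp, Matrix.mulVec_add, smul_add, Prod.fst_add]
      abel
    · change G *ᵥ ((u + v) ∘ Sum.inl) - s • ((u + v) ∘ Sum.inr) = _
      simp only [Pi.add_comp, Matrix.mulVec_add, smul_add, Prod.snd_add]
      abel
  · refine Prod.ext ?_ ?_
    · change (c • u) ∘ Sum.inl + s • G⁻¹ *ᵥ ((c • u) ∘ Sum.inr) = c • (u ∘ Sum.inl + s • G⁻¹ *ᵥ (u ∘ Sum.inr))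
      simp only [Pi.smul_comp, Matrix.mulVec_smul, smul_add, smul_comm s c]
    · change G *ᵥ ((c • u) ∘ Sum.inl) - s • ((c • u) ∘ Sum.inr) = c • (G *ᵥ (u ∘ Sum.inl) - s • (u ∘ Sum.inr))
      simp only [Pi.smul_comp, Matrix.mulVec_smul, smul_sub, smul_comm s c]
  · -- `β⁻¹ (β u) = u`
    change Sum.elim ((2 : K)⁻¹ • ((u ∘ Sum.inl + s • G⁻¹ *ᵥ (u ∘ Sum.inr)) + G⁻¹ *ᵥ (G *ᵥ (u ∘ Sum.inl) - s • (u ∘ Sum.inr))))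
      ((2 * s)⁻¹ • (G *ᵥ (u ∘ Sum.inl + s • G⁻¹ *ᵥ (u ∘ Sum.inr)) - (G *ᵥ (u ∘ Sum.inl) - s • (u ∘ Sum.inr)))) = u
    have h1 : (2 : K)⁻¹ • ((u ∘ Sum.inl + s • G⁻¹ *ᵥ (u ∘ Sum.inr)) + G⁻¹ *ᵥ (G *ᵥ (u ∘ Sum.inl) - s • (u ∘ Sum.inr))) =
        u ∘ Sum.inl := by
      rw [Matrix.mulVec_sub, Matrix.mulVec_mulVec, hGG, Matrix.one_mulVec, Matrix.mulVec_smul]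
      match_scalars <;> field_simp <;> ring
    have h2' : (2 * s)⁻¹ • (G *ᵥ (u ∘ Sum.inl + s • G⁻¹ *ᵥ (u ∘ Sum.inr)) - (G *ᵥ (u ∘ Sum.inl) - s • (u ∘ Sum.inr))) =
        u ∘ Sum.inr := by
      rw [Matrix.mulVec_add, Matrix.mulVec_smul, Matrix.mulVec_mulVec, hGG', Matrix.one_mulVec]
      match_scalars <;> field_simp <;> ring
    rw [h1, h2']
    funext i
    cases i <;> rfl
  · -- `β (β⁻¹ (p, q)) = (p, q)`
    obtain ⟨p, q⟩ := pq
    refine Prod.ext ?_ ?_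
    · change (Sum.elim ((2 : K)⁻¹ • (p + G⁻¹ *ᵥ q)) ((2 * s)⁻¹ • (G *ᵥ p - q)) ∘ Sum.inl) +
          s • G⁻¹ *ᵥ (Sum.elim ((2 : K)⁻¹ • (p + G⁻¹ *ᵥ q)) ((2 * s)⁻¹ • (G *ᵥ p - q)) ∘ Sum.inr) = p
      rw [Sum.elim_comp_inl, Sum.elim_comp_inr, Matrix.mulVec_smul, Matrix.mulVec_sub, Matrix.mulVec_mulVec, hGG,
        Matrix.one_mulVec]
      match_scalars <;> field_simp <;> ring
    · change G *ᵥ (Sum.elim ((2 : K)⁻¹ • (p + G⁻¹ *ᵥ q)) ((2 * s)⁻¹ • (G *ᵥ p - q)) ∘ Sum.inl) -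
          s • (Sum.elim ((2 : K)⁻¹ • (p + G⁻¹ *ᵥ q)) ((2 * s)⁻¹ • (G *ᵥ p - q)) ∘ Sum.inr) = q
      rw [Sum.elim_comp_inl, Sum.elim_comp_inr, Matrix.mulVec_smul, Matrix.mulVec_add, Matrix.mulVec_mulVec, hGG',
        Matrix.one_mulVec]
      match_scalars <;> field_simp <;> ring

end SplitEquiv

/-! ## §4 Unitarity in quadratic coordinates and the intertwining with the dual pair `(g_w, (g_w⁻¹)ᵀ)` -/

namespace IsQuadraticCoordinates

variable {R S : Type*} [CommRing R] [CommRing S]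
variable {φ : R →+* S} {Ψ : (R × R) ≃+ S} {δ : S} {d : R} (h : IsQuadraticCoordinates φ Ψ δ d)
include h

section MatrixParts

variable {m n p : Type*} [Fintype n]

/-- `re` of a matrix product: `(A B)₁ = A₁ B₁ + d · A₂ B₂` (`M₁ = re ∘ M`, `M₂ = im ∘ M` entrywise) — matrix
multiplication over `S = R ⊕ Rδ` in the coordinates of the restriction of scalars. [cite: GelbartRogawski1991, §3.1 p. 454] -/
theorem map_re_mul (A : Matrix m n S) (B : Matrix n p S) :
    (A * B).map (re Ψ) = A.map (re Ψ) * B.map (re Ψ) + d • (A.map (im Ψ) * B.map (im Ψ)) := by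
  ext i j
  simp only [Matrix.map_apply, Matrix.mul_apply, map_sum, h.re_mul, Matrix.add_apply, Matrix.smul_apply, smul_eq_mul,
    Finset.mul_sum, ← Finset.sum_add_distrib]

/-- `im` of a matrix product: `(A B)₂ = A₁ B₂ + A₂ B₁` (restriction of scalars `S = R ⊕ Rδ`). [cite: GelbartRogawski1991, §3.1 p. 454] -/
theorem map_im_mul (A : Matrix m n S) (B : Matrix n p S) :
    (A * B).map (im Ψ) = A.map (re Ψ) * B.map (im Ψ) + A.map (im Ψ) * B.map (re Ψ) := by
  ext i j
  simp only [Matrix.map_apply, Matrix.mul_apply, map_sum, h.im_mul, Matrix.add_apply, ← Finset.sum_add_distrib]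

omit [Fintype n] in
/-- `re (M.map σ) = re M` entrywise, for the conjugation `σ`. [folklore] -/
private theorem map_conj_map_re {σ : S →+* S} (hσφ : ∀ a, σ (φ a) = φ a) (hσδ : σ δ = -δ) (M : Matrix m n S) :
    (M.map σ).map (re Ψ) = M.map (re Ψ) := by
  ext i j
  exact h.re_conj hσφ hσδ (M i j)

omit [Fintype n] in
/-- `im (M.map σ) = -im M` entrywise, for the conjugation `σ`. [folklore] -/
private theorem map_conj_map_im {σ : S →+* S} (hσφ : ∀ a, σ (φ a) = φ a) (hσδ : σ δ = -δ) (M : Matrix m n S) :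
    (M.map σ).map (im Ψ) = -M.map (im Ψ) := by
  ext i j
  exact h.im_conj hσφ hσδ (M i j)

omit [Fintype n] in
/-- `re (T.map φ) = T`. [folklore] -/
private theorem map_map_re (T : Matrix m n R) : (T.map φ).map (re Ψ) = T := by
  ext i j
  exact h.re_map (T i j)

omit [Fintype n] in
/-- `im (T.map φ) = 0`. [folklore] -/
private theorem map_map_im (T : Matrix m n R) : (T.map φ).map (im Ψ) = 0 := by
  ext i j
  exact h.im_map (T i j)

omit [Fintype n] in
/-- a matrix over `S` is determined by its `re` and `im` parts. [folklore] -/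
private theorem matrix_eq_of_map_re_map_im {M M' : Matrix m n S} (hre : M.map (re Ψ) = M'.map (re Ψ))
    (him : M.map (im Ψ) = M'.map (im Ψ)) : M = M' := by
  ext i j
  rw [← h.re_add_im (M i j), ← h.re_add_im (M' i j)]
  have h1 := congrFun (congrFun hre i) j
  have h2 := congrFun (congrFun him i) j
  simp only [Matrix.map_apply] at h1 h2
  rw [h1, h2]

end MatrixParts

variable {κ : Type*} [Fintype κ] [DecidableEq κ]

omit [DecidableEq κ] in
/-- the `re` part of `(σg)ᵀ (T ⊗ 1) g` in coordinates: `g₁ᵀ T g₁ - d · g₂ᵀ T g₂` (any matrix `g = g₁ + g₂δ`).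
[cite: GelbartRogawski1991, §3.1 p. 454] -/
theorem map_re_conjTranspose_form_mul (T : Matrix κ κ R) {σ : S →+* S} (hσφ : ∀ a, σ (φ a) = φ a) (hσδ : σ δ = -δ)
    (g : Matrix κ κ S) :
    ((g.map σ)ᵀ * T.map φ * g).map (re Ψ) =
      (g.map (re Ψ))ᵀ * T * g.map (re Ψ) - d • ((g.map (im Ψ))ᵀ * T * g.map (im Ψ)) := by
  rw [h.map_re_mul, h.map_re_mul, h.map_im_mul, Matrix.transpose_map, Matrix.transpose_map, h.map_conj_map_re hσφ hσδ,
    h.map_conj_map_im hσφ hσδ, h.map_map_re, h.map_map_im]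
  simp only [Matrix.mul_zero, smul_zero, add_zero, zero_add, Matrix.transpose_neg, Matrix.neg_mul, smul_neg]
  rw [← sub_eq_add_neg]

omit [DecidableEq κ] in
/-- the `im` part of `(σg)ᵀ (T ⊗ 1) g` in coordinates: `g₁ᵀ T g₂ - g₂ᵀ T g₁` (any matrix `g = g₁ + g₂δ`).
[cite: GelbartRogawski1991, §3.1 p. 454] -/
theorem map_im_conjTranspose_form_mul (T : Matrix κ κ R) {σ : S →+* S} (hσφ : ∀ a, σ (φ a) = φ a) (hσδ : σ δ = -δ)
    (g : Matrix κ κ S) :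
    ((g.map σ)ᵀ * T.map φ * g).map (im Ψ) =
      (g.map (re Ψ))ᵀ * T * g.map (im Ψ) - (g.map (im Ψ))ᵀ * T * g.map (re Ψ) := by
  rw [h.map_im_mul, h.map_re_mul, h.map_im_mul, Matrix.transpose_map, Matrix.transpose_map, h.map_conj_map_re hσφ hσδ,
    h.map_conj_map_im hσφ hσδ, h.map_map_re, h.map_map_im]
  simp only [Matrix.mul_zero, smul_zero, add_zero, zero_add, Matrix.transpose_neg, Matrix.neg_mul]
  rw [← sub_eq_add_neg]

omit [DecidableEq κ] in
/-- **UNITARITY IN QUADRATIC COORDINATES**: a matrix `g = g₁ + g₂δ ∈ M_κ(S)` satisfies `(σg)ᵀ (T ⊗ 1) g = T ⊗ 1` iff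
`g₁ᵀ T g₁ - d · g₂ᵀ T g₂ = T` and `g₁ᵀ T g₂ = g₂ᵀ T g₁`. [cite: GelbartRogawski1991, §3.1 p. 454] -/
theorem conjTranspose_form_mul_eq_iff (T : Matrix κ κ R) {σ : S →+* S} (hσφ : ∀ a, σ (φ a) = φ a) (hσδ : σ δ = -δ)
    (g : Matrix κ κ S) :
    (g.map σ)ᵀ * T.map φ * g = T.map φ ↔
      (g.map (re Ψ))ᵀ * T * g.map (re Ψ) - d • ((g.map (im Ψ))ᵀ * T * g.map (im Ψ)) = T ∧
        (g.map (re Ψ))ᵀ * T * g.map (im Ψ) = (g.map (im Ψ))ᵀ * T * g.map (re Ψ) := by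
  constructor
  · intro hg
    refine ⟨?_, ?_⟩
    · have hre := congrArg (fun M : Matrix κ κ S => M.map (re Ψ)) hg
      simpa only [h.map_re_conjTranspose_form_mul T hσφ hσδ, h.map_map_re] using hre
    · have him := congrArg (fun M : Matrix κ κ S => M.map (im Ψ)) hg
      simpa only [h.map_im_conjTranspose_form_mul T hσφ hσδ, h.map_map_im, sub_eq_zero] using him
  · rintro ⟨hre, him⟩
    refine h.matrix_eq_of_map_re_map_im ?_ ?_
    · rw [h.map_re_conjTranspose_form_mul T hσφ hσδ, h.map_map_re, hre]
    · rw [h.map_im_conjTranspose_form_mul T hσφ hσδ, h.map_map_im, him, sub_self]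

/-- **UNITARITY IN QUADRATIC COORDINATES (real part)**: for `g = g₁ + g₂δ ∈ U(σ, T ⊗ 1)`,
`g₁ᵀ T g₁ - d · g₂ᵀ T g₂ = T`. [cite: GelbartRogawski1991, §3.1 p. 454] -/
theorem transpose_re_mul_re_sub_of_mem {T : Matrix κ κ R} {H : Matrix κ κ S} (hH : H = T.map φ) {σ : S →+* S}
    (hσφ : ∀ a, σ (φ a) = φ a) (hσδ : σ δ = -δ) {g : GL κ S} (hg : g ∈ unitaryGroupOfForm σ H) :
    ((g : Matrix κ κ S).map (re Ψ))ᵀ * T * (g : Matrix κ κ S).map (re Ψ) -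
        d • (((g : Matrix κ κ S).map (im Ψ))ᵀ * T * (g : Matrix κ κ S).map (im Ψ)) = T := by
  rw [mem_unitaryGroupOfForm_iff, hH, h.conjTranspose_form_mul_eq_iff T hσφ hσδ] at hg
  exact hg.1

/-- **UNITARITY IN QUADRATIC COORDINATES (imaginary part)**: for `g = g₁ + g₂δ ∈ U(σ, T ⊗ 1)`,
`g₁ᵀ T g₂ = g₂ᵀ T g₁`. [cite: GelbartRogawski1991, §3.1 p. 454] -/
theorem transpose_re_mul_im_eq_of_mem {T : Matrix κ κ R} {H : Matrix κ κ S} (hH : H = T.map φ) {σ : S →+* S}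
    (hσφ : ∀ a, σ (φ a) = φ a) (hσδ : σ δ = -δ) {g : GL κ S} (hg : g ∈ unitaryGroupOfForm σ H) :
    ((g : Matrix κ κ S).map (re Ψ))ᵀ * T * (g : Matrix κ κ S).map (im Ψ) =
      ((g : Matrix κ κ S).map (im Ψ))ᵀ * T * (g : Matrix κ κ S).map (re Ψ) := by
  rw [mem_unitaryGroupOfForm_iff, hH, h.conjTranspose_form_mul_eq_iff T hσφ hσδ] at hg
  exact hg.2

/-- **THE `w`- AND `w̄`-COMPONENTS ARE A DUAL PAIR**: for `g = g₁ + g₂δ ∈ U(σ, T ⊗ 1)` and `s² = d`,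
`(g₁ + s g₂)ᵀ T (g₁ - s g₂) = T`. [cite: Weil1965, Chap. II n° 21–23, pp. 32–36; Chap. VI n° 52, pp. 77–78] -/
theorem transpose_wComp_mul_mul_wbarComp {T : Matrix κ κ R} {H : Matrix κ κ S} (hH : H = T.map φ) {σ : S →+* S}
    (hσφ : ∀ a, σ (φ a) = φ a) (hσδ : σ δ = -δ) {s : R} (hs : s * s = d) {g : GL κ S}
    (hg : g ∈ unitaryGroupOfForm σ H) :
    ((g : Matrix κ κ S).map (re Ψ) + s • (g : Matrix κ κ S).map (im Ψ))ᵀ * T *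
        ((g : Matrix κ κ S).map (re Ψ) - s • (g : Matrix κ κ S).map (im Ψ)) = T := by
  have h1 := h.transpose_re_mul_re_sub_of_mem hH hσφ hσδ hg
  have h2 := h.transpose_re_mul_im_eq_of_mem hH hσφ hσδ hg
  simp only [Matrix.transpose_add, Matrix.transpose_smul, Matrix.add_mul, Matrix.mul_sub, Matrix.smul_mul,
    Matrix.mul_smul]
  simp only [smul_add, smul_smul]
  rw [h2, hs]
  convert h1 using 1
  abel

/-- … and symmetrically `(g₁ - s g₂)ᵀ T (g₁ + s g₂) = T`. [cite: Weil1965, Chap. II n° 21–23, pp. 32–36; Chap. VI n° 52, pp. 77–78] -/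
theorem transpose_wbarComp_mul_mul_wComp {T : Matrix κ κ R} {H : Matrix κ κ S} (hH : H = T.map φ) {σ : S →+* S}
    (hσφ : ∀ a, σ (φ a) = φ a) (hσδ : σ δ = -δ) {s : R} (hs : s * s = d) {g : GL κ S}
    (hg : g ∈ unitaryGroupOfForm σ H) :
    ((g : Matrix κ κ S).map (re Ψ) - s • (g : Matrix κ κ S).map (im Ψ))ᵀ * T *
        ((g : Matrix κ κ S).map (re Ψ) + s • (g : Matrix κ κ S).map (im Ψ)) = T := by
  have h1 := h.transpose_re_mul_re_sub_of_mem hH hσφ hσδ hg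
  have h2 := h.transpose_re_mul_im_eq_of_mem hH hσφ hσδ hg
  simp only [Matrix.transpose_sub, Matrix.transpose_smul, Matrix.sub_mul, Matrix.mul_add, Matrix.smul_mul,
    Matrix.mul_smul]
  simp only [smul_sub, smul_smul]
  rw [h2, hs]
  convert h1 using 1
  abel

/-! ### Reindexing helpers -/

omit h [DecidableEq κ] in
/-- `(reindex e e M) (v ∘ e⁻¹) = (M v) ∘ e⁻¹`. [folklore] -/
private theorem reindex_mulVec_comp {ι : Type*} [Fintype ι] [DecidableEq ι] (e : κ ≃ ι) (M : Matrix κ κ R) (v : κ → R) :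
    Matrix.reindex e e M *ᵥ (v ∘ e.symm) = (M *ᵥ v) ∘ e.symm := by
  rw [Matrix.reindex_apply, Matrix.submatrix_mulVec_equiv]
  congr 2
  funext i
  simp only [Function.comp_apply, Equiv.symm_symm, Equiv.symm_apply_apply]

omit h [DecidableEq κ] in
/-- `reindex e e A * reindex e e B = reindex e e (A * B)`. [folklore] -/
private theorem reindex_mul_reindex {ι : Type*} [Fintype ι] [DecidableEq ι] (e : κ ≃ ι) (A B : Matrix κ κ R) :
    Matrix.reindex e e A * Matrix.reindex e e B = Matrix.reindex e e (A * B) := by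
  rw [Matrix.reindex_apply, Matrix.reindex_apply, Matrix.reindex_apply, Matrix.submatrix_mul_equiv]

/-- **THE GEOMETRIC ACTION OF `U(σ, T ⊗ 1)` IN THE SPLIT COORDINATES IS THE DUAL PAIR `(g_w, (g_w⁻¹)ᵀ)`.**
For `g = g₁ + g₂δ ∈ U(σ, T.map φ)` (`T` symmetric, `G = reindex e e T` invertible, `s² = d`) put
`g_w := reindex e e (g₁ + s g₂) ∈ GL_ι(R)` (its inverse is `G⁻¹ (reindex e e (g₁ - s g₂))ᵀ G`).  Then for every
`u ∈ R^{ι ⊔ ι}`, with `A u := θ_G (g (θ_G⁻¹ u))` the geometric action (`θ_G` the Darboux map ★ `darboux`, `g` acting on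
`R^κ × R^κ = Res S^κ` through ★ `resAut`, reindexed by ★ `reindexW e` — the shape of ★ `Weil1965.UnitaryDoubling.vDiagAct`):
`(A u)₁ + s G⁻¹ (A u)₂ = g_w (u₁ + s G⁻¹ u₂)` and `G (A u)₁ - s (A u)₂ = (g_w⁻¹)ᵀ (G u₁ - s u₂)` — i.e.
`β ∘ A = (g_w, (g_w⁻¹)ᵀ) ∘ β` for the split coordinates `β` of `exists_splitEquiv`, the action
`z ↦ (g z.1, (g⁻¹)ᵀ z.2)` of ★ `Weil1965/SplitPlaceFibreMeasureInvariance`. [cite: Weil1965, Chap. II n° 21–23, pp. 32–36; Chap. VI n° 52, pp. 77–78] -/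
theorem exists_gl_split_intertwine {ι : Type*} [Fintype ι] [DecidableEq ι] (e : κ ≃ ι) {T : Matrix κ κ R}
    (hT : T.IsSymm) {G : Matrix ι ι R} (hTG : Matrix.reindex e e T = G) (hG : IsUnit G.det) {H : Matrix κ κ S}
    (hH : H = T.map φ) {σ : S →+* S} (hσφ : ∀ a, σ (φ a) = φ a) (hσδ : σ δ = -δ) {s : R} (hs : s * s = d)
    {g : GL κ S} (hg : g ∈ unitaryGroupOfForm σ H) :
    ∃ gW : GL ι R,
      (gW : Matrix ι ι R) = Matrix.reindex e e ((g : Matrix κ κ S).map (re Ψ) + s • (g : Matrix κ κ S).map (im Ψ)) ∧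
      ((gW⁻¹ : GL ι R) : Matrix ι ι R) =
        G⁻¹ * (Matrix.reindex e e ((g : Matrix κ κ S).map (re Ψ) - s • (g : Matrix κ κ S).map (im Ψ)))ᵀ * G ∧
      ∀ u : ι ⊕ ι → R,
        SymplecticMatrix.darboux G hG (reindexW R e (h.resAut κ g
              ((reindexW R e).symm ((SymplecticMatrix.darboux G hG).symm u)))) ∘ Sum.inl +
            s • G⁻¹ *ᵥ (SymplecticMatrix.darboux G hG (reindexW R e (h.resAut κ g
              ((reindexW R e).symm ((SymplecticMatrix.darboux G hG).symm u)))) ∘ Sum.inr) =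
          (gW : Matrix ι ι R) *ᵥ (u ∘ Sum.inl + s • G⁻¹ *ᵥ (u ∘ Sum.inr)) ∧
        G *ᵥ (SymplecticMatrix.darboux G hG (reindexW R e (h.resAut κ g
              ((reindexW R e).symm ((SymplecticMatrix.darboux G hG).symm u)))) ∘ Sum.inl) -
            s • (SymplecticMatrix.darboux G hG (reindexW R e (h.resAut κ g
              ((reindexW R e).symm ((SymplecticMatrix.darboux G hG).symm u)))) ∘ Sum.inr) =
          ((gW⁻¹ : GL ι R) : Matrix ι ι R)ᵀ *ᵥ (G *ᵥ (u ∘ Sum.inl) - s • (u ∘ Sum.inr)) := by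
  -- abbreviations
  set g₁ : Matrix κ κ R := (g : Matrix κ κ S).map (re Ψ) with hg₁
  set g₂ : Matrix κ κ R := (g : Matrix κ κ S).map (im Ψ) with hg₂
  have hGsymm : Gᵀ = G := by rw [← hTG, Matrix.transpose_reindex, hT]
  have hGG : G⁻¹ * G = 1 := Matrix.nonsing_inv_mul G hG
  have hGG' : G * G⁻¹ = 1 := Matrix.mul_nonsing_inv G hG
  -- the dual-pair identities, reindexed
  have hdual : (Matrix.reindex e e (g₁ - s • g₂))ᵀ * G * Matrix.reindex e e (g₁ + s • g₂) = G := by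
    rw [Matrix.transpose_reindex, ← hTG, reindex_mul_reindex, reindex_mul_reindex,
      h.transpose_wbarComp_mul_mul_wComp hH hσφ hσδ hs hg]
  have hdual' : (Matrix.reindex e e (g₁ + s • g₂))ᵀ * G * Matrix.reindex e e (g₁ - s • g₂) = G := by
    rw [Matrix.transpose_reindex, ← hTG, reindex_mul_reindex, reindex_mul_reindex,
      h.transpose_wComp_mul_mul_wbarComp hH hσφ hσδ hs hg]
  have hinv : G⁻¹ * (Matrix.reindex e e (g₁ - s • g₂))ᵀ * G * Matrix.reindex e e (g₁ + s • g₂) = 1 := by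
    rw [Matrix.mul_assoc (G⁻¹ * _), Matrix.mul_assoc G⁻¹, ← Matrix.mul_assoc _ G, hdual, hGG]
  have hinv' : Matrix.reindex e e (g₁ + s • g₂) * (G⁻¹ * (Matrix.reindex e e (g₁ - s • g₂))ᵀ * G) = 1 :=
    mul_eq_one_comm.1 hinv
  refine ⟨⟨Matrix.reindex e e (g₁ + s • g₂), G⁻¹ * (Matrix.reindex e e (g₁ - s • g₂))ᵀ * G, hinv', hinv⟩, rfl, rfl,
    fun u => ?_⟩
  -- the action in coordinates
  set a : κ → R := (u ∘ Sum.inl) ∘ e with ha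
  set b : κ → R := (G⁻¹ *ᵥ (u ∘ Sum.inr)) ∘ e with hb
  have hab : (reindexW R e).symm ((SymplecticMatrix.darboux G hG).symm u) = (a, b) := by
    rw [SymplecticMatrix.darboux_symm_apply, reindexW_symm_apply]
  have hact : SymplecticMatrix.darboux G hG (reindexW R e (h.resAut κ g
      ((reindexW R e).symm ((SymplecticMatrix.darboux G hG).symm u)))) =
      Sum.elim ((g₁ *ᵥ a + d • g₂ *ᵥ b) ∘ e.symm) (G *ᵥ ((g₂ *ᵥ a + g₁ *ᵥ b) ∘ e.symm)) := by
    rw [hab, h.resAut_apply_mk, reindexW_apply, SymplecticMatrix.darboux_apply]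
  have hu₁ : u ∘ Sum.inl = a ∘ e.symm := by
    funext i; simp only [ha, Function.comp_apply, Equiv.apply_symm_apply]
  have hu₂ : G⁻¹ *ᵥ (u ∘ Sum.inr) = b ∘ e.symm := by
    funext i; simp only [hb, Function.comp_apply, Equiv.apply_symm_apply]
  have hu₂' : u ∘ Sum.inr = G *ᵥ (b ∘ e.symm) := by
    rw [← hu₂, Matrix.mulVec_mulVec, hGG', Matrix.one_mulVec]
  rw [hact, Sum.elim_comp_inl, Sum.elim_comp_inr]
  refine ⟨?_, ?_⟩
  · -- first split coordinate: `g_w`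
    change _ = Matrix.reindex e e (g₁ + s • g₂) *ᵥ _
    rw [hu₁, hu₂, Matrix.mulVec_mulVec, hGG, Matrix.one_mulVec, ← Pi.smul_comp, ← Pi.add_comp, ← Pi.smul_comp,
      ← Pi.add_comp, reindex_mulVec_comp]
    congr 1
    rw [Matrix.add_mulVec, Matrix.smul_mulVec, Matrix.mulVec_add, Matrix.mulVec_add, Matrix.mulVec_smul,
      Matrix.mulVec_smul, ← hs, mul_smul, smul_add, smul_add]
    abel
  · -- second split coordinate: `(g_w⁻¹)ᵀ = G g_w̄ G⁻¹`
    change _ = (G⁻¹ * (Matrix.reindex e e (g₁ - s • g₂))ᵀ * G)ᵀ *ᵥ _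
    have hL : G *ᵥ ((g₁ *ᵥ a + d • g₂ *ᵥ b) ∘ ⇑e.symm) - s • G *ᵥ ((g₂ *ᵥ a + g₁ *ᵥ b) ∘ ⇑e.symm) =
        G *ᵥ (((g₁ *ᵥ a + d • g₂ *ᵥ b) - s • (g₂ *ᵥ a + g₁ *ᵥ b)) ∘ ⇑e.symm) := by
      rw [Pi.sub_comp, Pi.smul_comp, Matrix.mulVec_sub, Matrix.mulVec_smul]
    have hR : G *ᵥ (a ∘ ⇑e.symm) - s • G *ᵥ (b ∘ ⇑e.symm) = G *ᵥ ((a - s • b) ∘ ⇑e.symm) := by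
      rw [Pi.sub_comp, Pi.smul_comp, Matrix.mulVec_sub, Matrix.mulVec_smul]
    have hT' : (G⁻¹ * (Matrix.reindex e e (g₁ - s • g₂))ᵀ * G)ᵀ * G = G * Matrix.reindex e e (g₁ - s • g₂) := by
      rw [Matrix.transpose_mul, Matrix.transpose_mul, Matrix.transpose_transpose, Matrix.transpose_nonsing_inv, hGsymm,
        Matrix.mul_assoc, Matrix.mul_assoc, hGG, Matrix.mul_one]
    rw [hu₁, hu₂', hL, hR, Matrix.mulVec_mulVec, hT', ← Matrix.mulVec_mulVec, reindex_mulVec_comp]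
    congr 2
    rw [Matrix.sub_mulVec, Matrix.smul_mulVec, Matrix.mulVec_sub, Matrix.mulVec_sub, Matrix.mulVec_smul,
      Matrix.mulVec_smul, ← hs, mul_smul, smul_add, smul_sub]
    abel

end IsQuadraticCoordinates


/-! ## §5 Surjectivity: every `g_w ∈ GL_ι(K)` arises from `U(σ, T ⊗ 1)` at a split datum -/

namespace IsQuadraticCoordinates

variable {K S : Type*} [Field K] [CommRing S]
variable {φ : K →+* S} {Ψ : (K × K) ≃+ S} {δ : S} {d : K} (h : IsQuadraticCoordinates φ Ψ δ d)
include h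

variable {κ : Type*} [Fintype κ] [DecidableEq κ]

/-- **`U(σ, T ⊗ 1) → GL_ι(K)`, `g ↦ g_w = reindex e e (g₁ + s g₂)`, IS ONTO** (split datum: `s² = d`, `s ≠ 0`,
`2 ≠ 0`): for `P ∈ GL_ι(K)` the matrix `g = g₁ + g₂δ` with `reindex e e g₁ = ½(P + P̄)`,
`reindex e e g₂ = (2s)⁻¹(P - P̄)`, `P̄ := G⁻¹ (P⁻¹)ᵀ G`, is unitary with `g_w = P` (and `g_w̄ = P̄`) — at a place split in
the quadratic extension the unitary group IS the full linear group of the `w`-component, `U(i)_v ≅ GL_N(F_v)`.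
[cite: Weil1965, Chap. II n° 21–23, pp. 32–36; Chap. VI n° 52, pp. 77–78] -/
theorem exists_mem_unitaryGroupOfForm_of_gl {ι : Type*} [Fintype ι] [DecidableEq ι] (e : κ ≃ ι) {T : Matrix κ κ K}
    (hT : T.IsSymm) {G : Matrix ι ι K} (hTG : Matrix.reindex e e T = G) (hG : IsUnit G.det) {H : Matrix κ κ S}
    (hH : H = T.map φ) {σ : S →+* S} (hσφ : ∀ a, σ (φ a) = φ a) (hσδ : σ δ = -δ) {s : K} (hs : s * s = d)
    (hs0 : s ≠ 0) (h2 : (2 : K) ≠ 0) (P : GL ι K) :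
    ∃ g : GL κ S, g ∈ unitaryGroupOfForm σ H ∧
      Matrix.reindex e e ((g : Matrix κ κ S).map (re Ψ) + s • (g : Matrix κ κ S).map (im Ψ)) = (P : Matrix ι ι K) := by
  -- the two components `X = P`, `Y = P̄ = G⁻¹ (P⁻¹)ᵀ G`
  set X : Matrix ι ι K := (P : Matrix ι ι K) with hX
  set Y : Matrix ι ι K := G⁻¹ * ((P⁻¹ : GL ι K) : Matrix ι ι K)ᵀ * G with hY
  clear_value X Y
  have hGsymm : Gᵀ = G := by rw [← hTG, Matrix.transpose_reindex, hT]
  have hGG' : G * G⁻¹ = 1 := Matrix.mul_nonsing_inv G hG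
  have hPP : ((P⁻¹ : GL ι K) : Matrix ι ι K) * (P : Matrix ι ι K) = 1 := by
    rw [← Units.val_mul, inv_mul_cancel, Units.val_one]
  have hXY : Xᵀ * G * Y = G := by
    rw [hY]
    simp only [Matrix.mul_assoc]
    rw [← Matrix.mul_assoc G G⁻¹, hGG', Matrix.one_mul, ← Matrix.mul_assoc, ← Matrix.transpose_mul, hX, hPP,
      Matrix.transpose_one, Matrix.one_mul]
  have hYX : Yᵀ * G * X = G := by
    have h' := congrArg Matrix.transpose hXY
    rwa [Matrix.transpose_mul, Matrix.transpose_mul, Matrix.transpose_transpose, hGsymm, ← Matrix.mul_assoc] at h'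
  -- `A₀ = ½(X + Y)`, `B₀ = (2s)⁻¹(X - Y)`
  set A₀ : Matrix ι ι K := (2 : K)⁻¹ • (X + Y) with hA₀
  set B₀ : Matrix ι ι K := (2 * s)⁻¹ • (X - Y) with hB₀
  clear_value A₀ B₀
  have hw : A₀ + s • B₀ = X := by
    rw [hA₀, hB₀]
    match_scalars <;> field_simp <;> ring
  have h1 : A₀ᵀ * G * A₀ - (s * s) • (B₀ᵀ * G * B₀) = G := by
    rw [hA₀, hB₀]
    simp only [Matrix.transpose_smul, Matrix.transpose_add, Matrix.transpose_sub, Matrix.smul_mul, Matrix.mul_smul,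
      Matrix.add_mul, Matrix.sub_mul, Matrix.mul_add, Matrix.mul_sub, smul_add, smul_sub, smul_smul, hXY, hYX]
    match_scalars <;> field_simp <;> ring
  have h2' : A₀ᵀ * G * B₀ = B₀ᵀ * G * A₀ := by
    rw [hA₀, hB₀]
    simp only [Matrix.transpose_smul, Matrix.transpose_add, Matrix.transpose_sub, Matrix.smul_mul, Matrix.mul_smul,
      Matrix.add_mul, Matrix.sub_mul, Matrix.mul_add, Matrix.mul_sub, smul_add, smul_sub, smul_smul, hXY, hYX]
    match_scalars <;> field_simp
    ring
  -- the matrix `g` over `S` (coordinates reindexed to `κ`)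
  set A : Matrix κ κ K := Matrix.reindex e.symm e.symm A₀ with hA
  set B : Matrix κ κ K := Matrix.reindex e.symm e.symm B₀ with hB
  set gM : Matrix κ κ S := Matrix.of fun i j => Ψ (A i j, B i j) with hgM
  clear_value A B gM
  have hgre : gM.map (re Ψ) = A := by
    ext i j; simp only [hgM, Matrix.map_apply, Matrix.of_apply, re_apply]
  have hgim : gM.map (im Ψ) = B := by
    ext i j; simp only [hgM, Matrix.map_apply, Matrix.of_apply, im_apply]
  have hTG' : T = Matrix.reindex e.symm e.symm G := by
    rw [← hTG, ← Matrix.reindex_symm, Equiv.symm_apply_apply]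
  -- unitarity
  have hunit : (gM.map σ)ᵀ * T.map φ * gM = T.map φ := by
    rw [h.conjTranspose_form_mul_eq_iff T hσφ hσδ, hgre, hgim, hA, hB, hTG']
    simp only [Matrix.transpose_reindex, reindex_mul_reindex]
    refine ⟨?_, by rw [h2']⟩
    conv_rhs => rw [← h1]
    rw [← hs]
    ext i j
    simp only [Matrix.reindex_apply, Matrix.submatrix_apply, Matrix.sub_apply, Matrix.smul_apply]
  -- invertibility: `H⁻¹ (σg)ᵀ H` is a left inverse
  have hTdet : IsUnit (T.map φ).det := by
    rw [← RingHom.mapMatrix_apply, ← RingHom.map_det]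
    refine IsUnit.map _ ?_
    rw [hTG', Matrix.reindex_apply, Matrix.det_submatrix_equiv_self]
    exact hG
  have hleft : (T.map φ)⁻¹ * (gM.map σ)ᵀ * T.map φ * gM = 1 := by
    rw [Matrix.mul_assoc ((T.map φ)⁻¹ * _), Matrix.mul_assoc (T.map φ)⁻¹, ← Matrix.mul_assoc _ (T.map φ), hunit,
      Matrix.nonsing_inv_mul _ hTdet]
  have hgu : IsUnit gM := (Matrix.isUnit_iff_isUnit_det gM).2 (Matrix.isUnit_det_of_left_inverse hleft)
  refine ⟨hgu.unit, ?_, ?_⟩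
  · rw [mem_unitaryGroupOfForm_iff, hgu.unit_spec, hH, hunit]
  · rw [hgu.unit_spec, hgre, hgim, hA, hB, ← hw]
    ext i j
    simp only [Matrix.reindex_apply, Matrix.submatrix_apply, Matrix.add_apply, Matrix.smul_apply, Equiv.symm_symm,
      Equiv.apply_symm_apply]

end IsQuadraticCoordinates

end UnitaryGroup

end Literature.NumberTheory.Automorphic
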